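import Summits.Ventures.PercRepro.S2SeriesCapSeven
import Summits.Ventures.PercRepro.RankLevelSetFourCircuitNullityFour
import Summits.Ventures.PercRepro.S1CoreCapThirtyTwo
import Summits.Ventures.PercRepro.S1CoreCapChain
import Summits.Ventures.PercRepro.S1CoreDelete

/-!
# PercRepro — THE ITERATED SERIES-CLASS LEVER `gb d n` FOR `s₄` (p2, gen 21; SUBCLAIM-S1 §6.5 (iv))

p7's series-class averaging (S2SeriesCapSeven, nullity `7`) iterated over the nullity with the point count carried along:
on the COLOOP-FREE part `P = M ＼ M.coloops` of an `e`-free core of nullity `d + 5` with `n` points, either some point `e`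
has `≥ 3` series partners (coloops of `P ＼ {e}`) — then `e` lies on at most one quad and `s₄ ≤ avgChain16 (d + 4) + 1` —
or every point has `≤ 2`, and the averaged point `x` (on `≤ ⌊4·s₄/n⌋` quads) leaves a core `P ＼ {x}` of nullity `d + 4`
with `≥ n − 3` non-coloops, so `s₄ ≤ ⌊n·gb (d + 4) (n − 3)/(n − 4)⌋`. Values: `gb 5 = 28, 26, 25, 24, 23, 22, 21, …` at
`n = 9, 10, …`; `gb 6 = 46, 44, 42, 37, 35, 32, 30, 29, …` at `n = 10, …`; `gb 7 18 = 47` (p7's `48`); **`gb 9 19 = 111`**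
(the cell `(10, 9)` needs `≤ 114`; the plain lever gives `125`).

* `coloops_delete_coloops`, `fourCircuits_delete_coloops`, `encard_delete_coloops`, `ncard_ground_delete_coloops`
  — the coloop-free part of a core; `gbFloor`, `gb`, `gb_of_le_four`, `gb_succ`;
* **`ncard_fourCircuits_le_gb`** — `s₄ ≤ gb d n` on every `e`-free core of nullity `d` with `≥ n` non-coloops;
* `ncard_fourCircuits_le_gb_of_coloopFree` — the coloop-free form with `n = |E|`.
Axioms: standard.
-/

open scoped Matroid

namespace PercRepro

namespace S1

open Set

variable {α : Type}

/-- The coloop-free part `M ＼ M.coloops` has no coloops. -/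
theorem coloops_delete_coloops (M : Matroid α) : (M ＼ M.coloops).coloops = ∅ := by
  rw [← Matroid.contract_eq_delete_of_subset_coloops subset_rfl, Matroid.contract_coloops_eq, Set.sdiff_self]

/-- The four-circuits of the coloop-free part are those of `M` (a coloop is on no circuit). -/
theorem fourCircuits_delete_coloops (M : Matroid α) :
    {C : Set α | (M ＼ M.coloops).IsCircuit C ∧ C.ncard = 4} = {C : Set α | M.IsCircuit C ∧ C.ncard = 4} := by
  ext C
  simp only [mem_setOf_eq, Matroid.delete_isCircuit_iff]
  constructor
  · rintro ⟨⟨hC, -⟩, h4⟩; exact ⟨hC, h4⟩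
  · rintro ⟨hC, h4⟩; exact ⟨⟨hC, hC.disjoint_coloops⟩, h4⟩

/-- The ground set of the coloop-free part counts the non-coloops. -/
theorem ncard_ground_delete_coloops (M : Matroid α) : (M ＼ M.coloops).E.ncard = (M.E \ M.coloops).ncard := by
  rw [_root_.Matroid.delete_ground]

/-- The coloop-free part keeps the nullity: `|E ∖ K| = r(E ∖ K) + d` when `|E| = r(E) + d`. -/
theorem encard_delete_coloops (M : Matroid α) [M.Finite] {d : ℕ} (hd : M.E.encard = M.eRank + d) :
    (M ＼ M.coloops).E.encard = (M ＼ M.coloops).eRank + d := by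
  have hK : M.coloops ⊆ M.E := M.coloops_subset_ground
  have hE' : M.E \ M.coloops ⊆ M.E := sdiff_subset
  have hunion : (M.E \ M.coloops) ∪ M.coloops = M.E := sdiff_union_of_subset hK
  have hr := PercRepro.eRk_union_subset_coloops (M := M) hE' subset_rfl disjoint_sdiff_left
  rw [hunion, ← _root_.Matroid.eRank_def] at hr
  have hKfin : M.coloops.Finite := M.ground_finite.subset hK
  have hKtop : M.coloops.encard ≠ ⊤ := hKfin.encard_lt_top.ne
  have hcard : (M.E \ M.coloops).encard + M.coloops.encard = M.E.encard :=
    Set.encard_sdiff_add_encard_of_subset hK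
  have hR' : (M ＼ M.coloops).eRank = M.eRk (M.E \ M.coloops) := by
    rw [_root_.Matroid.delete_eq_restrict, _root_.Matroid.eRank_restrict]
  rw [_root_.Matroid.delete_ground, hR']
  have h : (M.E \ M.coloops).encard + M.coloops.encard = (M.eRk (M.E \ M.coloops) + d) + M.coloops.encard := by
    rw [hcard, hd, hr]; ring
  exact WithTop.add_right_cancel hKtop h

/-- The least number of non-coloops of a core of nullity `d`: `d + 4` for `d ≤ 6`, `d + 5` beyond. -/
def gbFloor (d : ℕ) : ℕ := if d ≤ 6 then d + 4 else d + 5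

/-- **THE ITERATED SERIES-CLASS LEVER**: `gb d n` bounds `s₄` on every `e`-free core of nullity `d` with at least `n`
non-coloops — `avgChain16 d` at `d ≤ 4`, then the larger of `avgChain16 (d − 1) + 1` (a point with `≥ 3` series partners)
and `⌊n'·gb (d − 1) (n' − 3)/(n' − 4)⌋` with `n' = max n (gbFloor d)` (the averaged point). -/
def gb : ℕ → ℕ → ℕ
  | 0, _ => ThmN.avgChain16 0
  | 1, _ => ThmN.avgChain16 1
  | 2, _ => ThmN.avgChain16 2
  | 3, _ => ThmN.avgChain16 3
  | 4, _ => ThmN.avgChain16 4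
  | d + 5, n => max (ThmN.avgChain16 (d + 4) + 1)
      (max n (gbFloor (d + 5)) * gb (d + 4) (max n (gbFloor (d + 5)) - 3) / (max n (gbFloor (d + 5)) - 4))

/-- `gb d n = avgChain16 d` for `d ≤ 4`. -/
theorem gb_of_le_four {d : ℕ} (hd : d ≤ 4) (n : ℕ) : gb d n = ThmN.avgChain16 d := by
  interval_cases d <;> rfl

/-- The unfolding of `gb` at nullity `d + 5`. -/
theorem gb_succ (d n : ℕ) : gb (d + 5) n = max (ThmN.avgChain16 (d + 4) + 1)
    (max n (gbFloor (d + 5)) * gb (d + 4) (max n (gbFloor (d + 5)) - 3) / (max n (gbFloor (d + 5)) - 4)) := rfl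

/-- The values `gb 9 19 = 111`, `gb 7 18 = 47`, `gb 6 15 = 32`, `gb 5 9 = 28`. -/
theorem gb_values : gb 9 19 = 111 ∧ gb 7 18 = 47 ∧ gb 6 15 = 32 ∧ gb 5 9 = 28 := by decide

/-- **`s₄ ≤ gb d n` on every `e`-free core of nullity `d` with at least `n` non-coloops.** -/
theorem ncard_fourCircuits_le_gb (d : ℕ) : ∀ (M : Matroid α) [M.Finite],
    (∀ e ∈ M.E, ∃ A ⊆ M.E \ {e}, e ∉ M.closure A ∧ e ∉ M.closure ((M.E \ {e}) \ A)) →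
    M.E.encard = M.eRank + d → ∀ n, n ≤ (M.E \ M.coloops).ncard →
    {C : Set α | M.IsCircuit C ∧ C.ncard = 4}.ncard ≤ gb d n := by
  induction d with
  | zero =>
    intro M _ hfree hd n _
    rw [gb_of_le_four (by norm_num)]
    exact ThmN.ncard_fourCircuits_le_avgChain16 0 M hfree hd
  | succ d ih =>
    intro M _ hfree hd n hn
    rcases Nat.lt_or_ge d 4 with hd4 | hd4
    · rw [gb_of_le_four (by omega)]
      exact ThmN.ncard_fourCircuits_le_avgChain16 (d + 1) M hfree hd
    obtain ⟨d', rfl⟩ : ∃ d', d = d' + 4 := ⟨d - 4, by omega⟩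
    rw [show d' + 4 + 1 = d' + 5 by ring] at hd ⊢
    rw [gb_succ]
    classical
    -- the coloop-free part `P`
    set P := M ＼ M.coloops with hPdef
    have hPcol : P.coloops = ∅ := coloops_delete_coloops M
    have hPfree := hfree_delete_set M hfree M.coloops
    have hPd : P.E.encard = P.eRank + ((d' + 5 : ℕ) : ℕ∞) := encard_delete_coloops M hd
    have hPd' : P.E.encard = P.eRank + ((d' + 4 : ℕ) + 1) := by rw [hPd]; push_cast; ring
    have hPs : {C : Set α | P.IsCircuit C ∧ C.ncard = 4} = {C : Set α | M.IsCircuit C ∧ C.ncard = 4} :=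
      fourCircuits_delete_coloops M
    have hPn : P.E.ncard = (M.E \ M.coloops).ncard := ncard_ground_delete_coloops M
    -- the floor on the non-coloops
    have hfloor : gbFloor (d' + 5) ≤ P.E.ncard := by
      rw [hPn]
      unfold gbFloor
      rcases Nat.lt_or_ge d' 2 with h2 | h2
      · interval_cases d'
        · simp only [show (0 + 5 : ℕ) ≤ 6 by norm_num, if_true]
          exact card_nonColoops_ge_nine M hfree (by exact_mod_cast hd)
        · simp only [show (1 + 5 : ℕ) ≤ 6 by norm_num, if_true]
          exact card_nonColoops_ge_ten M hfree (by exact_mod_cast hd)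
      · rw [if_neg (by omega)]
        have h := card_nonColoops_ge M hfree (d := d' + 4) (by rw [hd]; push_cast; ring) (by omega)
        omega
    set n' := max n (gbFloor (d' + 5)) with hn'
    have hn'P : n' ≤ P.E.ncard := by rw [hPn] at hfloor ⊢; exact max_le hn hfloor
    have hn'9 : 9 ≤ n' := by
      have : 9 ≤ gbFloor (d' + 5) := by unfold gbFloor; split_ifs <;> omega
      exact this.trans (le_max_right _ _)
    rw [← hPs]
    by_cases hA : ∃ e ∈ P.E, 3 ≤ (P ＼ {e}).coloops.ncard
    · -- CASE A: a point with `≥ 3` series partners lies on at most one quad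
      obtain ⟨e, heE, hk3⟩ := hA
      have hec : ¬ P.IsColoop e := by
        rw [Matroid.isColoop_iff_mem_coloops, hPcol]; exact Set.notMem_empty e
      have hthr : {C : Set α | P.IsCircuit C ∧ C.ncard = 4 ∧ e ∈ C}.ncard ≤ 1 := by
        rcases Nat.lt_or_ge (P ＼ {e}).coloops.ncard 4 with hk4 | hk4
        · exact S2.ncard_fourCircuitsThrough_le_one_of_three P hPcol e (by omega)
        · rw [S2.ncard_fourCircuitsThrough_eq_zero_of_four_le P hPcol e hk4]; norm_num
      have hsplit := ncard_fourCircuits_le_through_add_delete P e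
      have hde : (P ＼ {e}).E.encard = (P ＼ {e}).eRank + ((d' + 4 : ℕ) : ℕ∞) :=
        S2.delete_nullity_of_nonColoop' P hPd' heE hec
      have hrec := ThmN.ncard_fourCircuits_le_avgChain16 (d' + 4) (P ＼ {e}) (hfree_delete P hPfree e) hde
      exact le_max_of_le_left (by omega)
    · -- CASE B: every point has `≤ 2` series partners — the averaged point `x`
      push Not at hA
      apply le_max_of_le_right
      rcases Nat.eq_zero_or_pos {C : Set α | P.IsCircuit C ∧ C.ncard = 4}.ncard with h0 | hpos
      · rw [h0]; exact Nat.zero_le _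
      obtain ⟨x, hxE, -, hx⟩ := exists_nonColoop_ncard_fourCircuitsThrough_le P hpos
      have hmn : (P.ground_finite.toFinset.filter (fun y => ¬ P.IsColoop y)).card = P.E.ncard := by
        rw [Finset.filter_true_of_mem, ← Set.ncard_eq_toFinset_card _ P.ground_finite]
        intro y _
        rw [Matroid.isColoop_iff_mem_coloops, hPcol]
        exact Set.notMem_empty y
      rw [hmn] at hx
      have hx' : {C : Set α | P.IsCircuit C ∧ C.ncard = 4 ∧ x ∈ C}.ncard ≤
          4 * {C : Set α | P.IsCircuit C ∧ C.ncard = 4}.ncard / n' :=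
        hx.trans (Nat.div_le_div_left hn'P (by omega))
      -- `P ＼ {x}`: a core of nullity `d' + 4` with `≥ n' − 3` non-coloops
      have hxc : ¬ P.IsColoop x := by
        rw [Matroid.isColoop_iff_mem_coloops, hPcol]; exact Set.notMem_empty x
      have hdx : (P ＼ {x}).E.encard = (P ＼ {x}).eRank + ((d' + 4 : ℕ) : ℕ∞) :=
        S2.delete_nullity_of_nonColoop' P hPd' hxE hxc
      have hk2 : (P ＼ {x}).coloops.ncard ≤ 2 := by have := hA x hxE; omega
      have hxn : (P ＼ {x}).E.ncard + 1 = P.E.ncard := by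
        rw [_root_.Matroid.delete_ground]
        exact Set.ncard_sdiff_singleton_add_one hxE P.ground_finite
      have hnc : n' - 3 ≤ ((P ＼ {x}).E \ (P ＼ {x}).coloops).ncard := by
        have hKsub : (P ＼ {x}).coloops ⊆ (P ＼ {x}).E := (P ＼ {x}).coloops_subset_ground
        rw [Set.ncard_sdiff hKsub ((P ＼ {x}).ground_finite.subset hKsub)]
        omega
      have hrec := ih (P ＼ {x}) (hfree_delete P hPfree x) hdx (n' - 3) hnc
      have hsplit := ncard_fourCircuits_le_through_add_delete P x
      have hsub : {C : Set α | P.IsCircuit C ∧ C.ncard = 4}.ncard -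
          4 * {C : Set α | P.IsCircuit C ∧ C.ncard = 4}.ncard / n' ≤ gb (d' + 4) (n' - 3) := by omega
      exact le_mul_div_of_sub_div_le (by omega) hsub

/-- **The coloop-free form**: on a coloop-free `e`-free core of nullity `d` on `n` points, `s₄ ≤ gb d n`. -/
theorem ncard_fourCircuits_le_gb_of_coloopFree (M : Matroid α) [M.Finite]
    (hfree : ∀ e ∈ M.E, ∃ A ⊆ M.E \ {e}, e ∉ M.closure A ∧ e ∉ M.closure ((M.E \ {e}) \ A))
    {d : ℕ} (hd : M.E.encard = M.eRank + d) (hcol : M.coloops = ∅) {n : ℕ} (hn : M.E.ncard = n) :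
    {C : Set α | M.IsCircuit C ∧ C.ncard = 4}.ncard ≤ gb d n :=
  ncard_fourCircuits_le_gb d M hfree hd n (by rw [hcol, Set.sdiff_empty, hn])

end S1

end PercRepro
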